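import Summits.ResolutionOfSingularities.ResolutionOfSingularities.Theorems.EquisingularLiftEquisingularLiftNatFanGamePhaseOne
import HarnessLib

/-!
# [OURS · L1 W4.5(b) · EL♮(3) · D-0157 DOOR 1, WIDTH row iso-w4] FAN-GAME WINNABILITY — brick 2c: PHASE 2 (wall-crossing pairs, one wall at a time)

res-L1-w45b-iso-w4 g0 (prover, width seat; desk WIDTH TABLE D1/D1′; referee crit-2). `--supports stmt-ResolutionOfSingularities-20148 --as helper`.
Sorry-free, fact-free. OURS; counted 0; AI kernel work, weaker than expert review; NOT a statement of any manuscript; nothing of [Hironaka2017] is used;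
resolution of singularities in characteristic `p` is NOT proved here or anywhere in this chain.
Blueprint: `L/res-L1-w45b-iso-w4/FANGAME-MEMO.md` §6 («NODES FIRST, THEN WALLS»).

## What is proved

* `FanGame.zOf`, `xPt`, `WCross V m m' u v` — the W-CROSSING pairs of the ordered pair `(m, m')`: `⟨·,m⟩ − ⟨·,m'⟩` positive at `u`, negative at `v`, and
  `m` minimal over the table at the crossing point `x_{uv} = ℓ(u)•v + (−ℓ(v))•u`; `wcross_swap`.
* ★ `FanGame.bad_of_wcross` — LEGALITY: a W-crossing pair is `Bad`.
* ★★ `FanGame.wcross_of_wcross_of_pos` / `_of_neg` — THE EXTREME PROPERTY: in a separated position of smooth cones (≤ 3 rays) in which every node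
  direction is a ray, if `{p,q}` is W-crossing in a cone `σ` then so is `{r,q}` for every other ray `r ∈ σ` with `ℓ r > 0` (TAKEOVER along the chord
  of the wall hyperplane; the catch-up point would be a node inside `σ`; FAN EXCLUSION).
* `FanGame.NoWCross` and ★★ `FanGame.phase2_pair` — PHASE 2 for one pair: the engine of brick 1 (`measure_star_lt`, p644055) run on W-crossing pairs
  reaches, E1-legally, a position without W-crossing pair for `(m, m')`, node directions still rays.
-/

set_option linter.dupNamespace false

open Matrix

namespace Summit.ResolutionOfSingularities.ResolutionOfSingularities.Cruxes.EquisingularLiftNat.Sections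

namespace FanGame

/-! ### PHASE 2: wall-crossing pairs -/

variable {n : ℕ}

/-- The integer vector `m − m'` of a pair of exponents; its linear form is `lin (zOf m m') ρ = ⟨ρ, m⟩ − ⟨ρ, m'⟩`. [OURS · bookkeeping] -/
def zOf (m m' : Fin n → ℕ) : Fin n → ℤ := fun i => (m i : ℤ) - m' i

/-- `lin (zOf m m') ρ = pair ρ m − pair ρ m'`. -/
theorem lin_zOf (m m' : Fin n → ℕ) (ρ : Ray n) : lin (zOf m m') ρ = pair ρ m - pair ρ m' := by
  simp only [lin, zOf, pair, mul_sub, Finset.sum_sub_distrib]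

/-- `lin` is homogeneous in the ray. -/
theorem lin_smul (z : Fin n → ℤ) (k : ℤ) (ρ : Ray n) : lin z (k • ρ) = k * lin z ρ := by
  simp only [lin, Pi.smul_apply, smul_eq_mul, mul_assoc, Finset.mul_sum]

/-- The crossing point of the wall hyperplane `⟨·, m⟩ = ⟨·, m'⟩` with the segment from `u` to `v` (when `ℓ u > 0 > ℓ v`): the lattice point
`ℓ(u) • v + (−ℓ(v)) • u`. [OURS · bookkeeping] -/
def xPt (m m' : Fin n → ℕ) (u v : Ray n) : Ray n := (lin (zOf m m') u) • v + (-lin (zOf m m') v) • u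

/-- The crossing point lies on the wall hyperplane. -/
theorem lin_xPt (m m' : Fin n → ℕ) (u v : Ray n) : lin (zOf m m') (xPt m m' u v) = 0 := by
  rw [xPt, lin_add, lin_smul, lin_smul]; ring

/-- **W-CROSSING pair** for the ordered pair `(m, m')`: `⟨·, m⟩ − ⟨·, m'⟩` is positive at `u`, negative at `v`, and `m` (hence also `m'`) MINIMISES
over the table at the crossing point — the segment `[u, v]` meets the actual wall between the domains of `m` and `m'`. [OURS · bookkeeping] -/
def WCross (V : Finset (Fin n → ℕ)) (m m' : Fin n → ℕ) (u v : Ray n) : Prop :=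
  0 < lin (zOf m m') u ∧ lin (zOf m m') v < 0 ∧ ∀ m'' ∈ V, pair (xPt m m' u v) m ≤ pair (xPt m m' u v) m''

/-- Swapping the pair and the rays: the crossing point is the same. -/
theorem xPt_swap (m m' : Fin n → ℕ) (u v : Ray n) : xPt m' m v u = xPt m m' u v := by
  have h : ∀ ρ, lin (zOf m' m) ρ = -lin (zOf m m') ρ := fun ρ => by rw [lin_zOf, lin_zOf]; ring
  rw [xPt, xPt, h, h, neg_neg, add_comm]

/-- `WCross` is symmetric under swapping the pair together with the rays. -/
theorem wcross_swap {V : Finset (Fin n → ℕ)} {m m' : Fin n → ℕ} {u v : Ray n} (h : WCross V m m' u v) : WCross V m' m v u := by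
  obtain ⟨hu, hv, hmin⟩ := h
  have hl : ∀ ρ, lin (zOf m' m) ρ = -lin (zOf m m') ρ := fun ρ => by rw [lin_zOf, lin_zOf]; ring
  refine ⟨by rw [hl]; linarith, by rw [hl]; linarith, fun m'' hm'' => ?_⟩
  rw [xPt_swap]
  have h0 := lin_xPt m m' u v
  rw [lin_zOf] at h0
  linarith [hmin m'' hm'']

/-- **LEGALITY: a W-crossing pair is `Bad`** (for `m, m' ∈ V`): a common minimiser on `{u, v}` is minimal at the crossing point, where `m` and `m'`
are minimal and tie — forcing `⟨u, m⟩ = ⟨u, m'⟩`. [OURS · L1 W4.5b · brick 2c] -/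
theorem bad_of_wcross {V : Finset (Fin n → ℕ)} {m m' : Fin n → ℕ} (hm : m ∈ V) (hm' : m' ∈ V) {u v : Ray n}
    (h : WCross V m m' u v) : Bad V ({u, v} : Finset (Ray n)) := by
  obtain ⟨hu, hv, hmin⟩ := h
  rintro ⟨m₀, hm₀, hmin₀⟩
  have hum := hmin₀ u (by simp) m hm
  have hum' := hmin₀ u (by simp) m' hm'
  have hvm := hmin₀ v (by simp) m hm
  have hvm' := hmin₀ v (by simp) m' hm'
  have hx0 := hmin m₀ hm₀
  have htie : pair (xPt m m' u v) m = pair (xPt m m' u v) m' := by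
    have := lin_xPt m m' u v; rw [lin_zOf] at this; linarith
  -- expand `pair` at the crossing point
  have hexp : ∀ mm : Fin n → ℕ, pair (xPt m m' u v) mm = lin (zOf m m') u * pair v mm + (-lin (zOf m m') v) * pair u mm := by
    intro mm; rw [xPt, pair_add, pair_smul, pair_smul]
  rw [hexp, hexp] at hx0
  rw [hexp, hexp] at htie
  have ha : 0 < lin (zOf m m') u := hu
  have hb : 0 < -lin (zOf m m') v := by linarith
  have hu0 : lin (zOf m m') u = pair u m - pair u m' := lin_zOf m m' u
  nlinarith [mul_nonneg ha.le (sub_nonneg.2 hvm), mul_nonneg hb.le (sub_nonneg.2 hum),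
    mul_nonneg ha.le (sub_nonneg.2 hvm'), mul_nonneg hb.le (sub_nonneg.2 hum')]

/-- `xPt` is a non-negative combination of two non-negative rays: coordinates. -/
theorem xPt_nonneg {m m' : Fin n → ℕ} {u v : Ray n} (hu : ∀ i, 0 ≤ u i) (hv : ∀ i, 0 ≤ v i) (hlu : 0 < lin (zOf m m') u)
    (hlv : lin (zOf m m') v < 0) : ∀ i, 0 ≤ xPt m m' u v i := fun i => by
  simp only [xPt, Pi.add_apply, Pi.smul_apply, smul_eq_mul]
  nlinarith [hu i, hv i]

/-- In a cone with at most three rays, three distinct members exhaust it. -/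
theorem mem_three_of_card_le {σ : Finset (Ray 3)} (hcard : σ.card ≤ 3) {p q r x : Ray 3} (hp : p ∈ σ) (hq : q ∈ σ) (hr : r ∈ σ)
    (hpq : p ≠ q) (hqr : q ≠ r) (hrp : r ≠ p) (hx : x ∈ σ) : x = p ∨ x = q ∨ x = r := by
  classical
  by_contra h
  push Not at h
  obtain ⟨h1, h2, h3⟩ := h
  have hsub : ({p, q, r, x} : Finset (Ray 3)) ⊆ σ := by
    intro y hy; simp only [Finset.mem_insert, Finset.mem_singleton] at hy
    rcases hy with rfl | rfl | rfl | rfl <;> assumption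
  have hc := Finset.card_le_card hsub
  rw [Finset.card_insert_of_notMem (by simp [hpq, hrp.symm, Ne.symm h1]), Finset.card_insert_of_notMem (by simp [hqr, Ne.symm h2]),
    Finset.card_pair (Ne.symm h3)] at hc
  omega

/-- A non-zero non-negative ray has a positive coordinate. -/
theorem exists_pos_coord {ρ : Ray 3} (h0 : ∀ i, 0 ≤ ρ i) (hne : ρ ≠ 0) : ∃ i, 0 < ρ i := by
  by_contra h; push Not at h
  exact hne (funext fun i => le_antisymm (h i) (h0 i))

/-- **THE EXTREME PROPERTY (positive side).**  In a separated position of smooth cones with at most three rays in which every node direction is a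
ray, if `{p, q}` is a W-crossing pair of a cone `σ` and `r ∈ σ` is another ray with `ℓ r > 0`, then `{r, q}` is W-crossing too.  (Else the first
catch-up point of `m` along the chord `[x_{pq}, x_{rq}]` of the wall hyperplane is a node point inside the cone; its direction is a ray of the
position, hence — FAN EXCLUSION — a ray of `σ` on the hyperplane; but `ℓ ≠ 0` on `p, q, r`.) [OURS · L1 W4.5b · brick 2c] -/
theorem wcross_of_wcross_of_pos {V : Finset (Fin 3 → ℕ)} {F : Finset (Finset (Ray 3))} (hSep : Separated F) (hN : NodesResolved V F)
    {σ : Finset (Ray 3)} (hσF : σ ∈ F) (hσ : ND.IsSmoothCone σ) (hcard : σ.card ≤ 3) {m m' : Fin 3 → ℕ} (hm : m ∈ V) (hm' : m' ∈ V)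
    (hmm' : m ≠ m') {p q r : Ray 3} (hp : p ∈ σ) (hq : q ∈ σ) (hr : r ∈ σ) (hrp : r ≠ p)
    (hW : WCross V m m' p q) (hlr : 0 < lin (zOf m m') r) : WCross V m m' r q := by
  classical
  obtain ⟨hlp, hlq, hmin⟩ := hW
  refine ⟨hlr, hlq, ?_⟩
  by_contra hnot
  push Not at hnot
  obtain ⟨m'', hm''V, hlt⟩ := hnot
  -- TAKEOVER along the chord from `x_{pq}` to `x_{rq}`
  obtain ⟨m₁, hm₁, A, B, hA, hB, -, hBeq, hminy, htie⟩ :=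
    takeover V (xPt m m' p q) (xPt m m' r q) hmin ⟨m'', hm''V, hlt⟩
  set y := B • xPt m m' p q + A • xPt m m' r q with hy
  -- `y` is on the hyperplane, so `m'` is minimal at `y` as well
  have hly : lin (zOf m m') y = 0 := by rw [hy, lin_add, lin_smul, lin_smul, lin_xPt, lin_xPt]; ring
  have htie' : pair y m' = pair y m := by rw [lin_zOf] at hly; linarith
  -- the differences `m' − m`, `m₁ − m` are independent
  have hind : Indep (ND.rayOf m' - ND.rayOf m) (ND.rayOf m₁ - ND.rayOf m) := by
    intro a b hab
    have h1 : a * (pair (xPt m m' r q) m' - pair (xPt m m' r q) m) = b * (pair (xPt m m' r q) m₁ - pair (xPt m m' r q) m) := by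
      have := congr_arg (fun d => xPt m m' r q ⬝ᵥ d) hab
      simp only [dotProduct_smul, dotProduct_sub, ← pair_eq_dotProduct, smul_eq_mul] at this
      exact this
    have h2 : pair (xPt m m' r q) m' - pair (xPt m m' r q) m = 0 := by
      have := lin_xPt m m' r q; rw [lin_zOf] at this; linarith
    rw [h2, mul_zero] at h1
    have hb : b = 0 := by
      have h3 : pair (xPt m m' r q) m₁ - pair (xPt m m' r q) m = -B := by linarith
      rw [h3] at h1
      have : b * B = 0 := by linarith
      rcases mul_eq_zero.1 this with h | h
      · exact h
      · exact absurd h hB.ne'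
    subst hb
    rw [zero_smul] at hab
    rcases smul_eq_zero.1 hab with h | h
    · exact ⟨h, rfl⟩
    · exfalso; apply hmm'
      have : ND.rayOf m' = ND.rayOf m := sub_eq_zero.1 h
      funext i; have := congr_fun this i; simpa [ND.rayOf] using this.symm
  have hnode : IsNodePoint V y := ⟨m, hm, m', hm', m₁, hm₁, hminy, htie', htie, hind⟩
  -- `y` lies in the closed orthant and is non-zero
  have hp0 := ND.ray_nonneg_of_isSmoothCone hσ hp
  have hq0 := ND.ray_nonneg_of_isSmoothCone hσ hq
  have hr0 := ND.ray_nonneg_of_isSmoothCone hσ hr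
  have hxpq := xPt_nonneg (m := m) (m' := m') hp0 hq0 hlp hlq
  have hxrq := xPt_nonneg (m := m) (m' := m') hr0 hq0 hlr hlq
  have hy0 : ∀ i, 0 ≤ y i := fun i => by
    simp only [hy, Pi.add_apply, Pi.smul_apply, smul_eq_mul]; nlinarith [hxpq i, hxrq i]
  have hyne : y ≠ 0 := by
    obtain ⟨i, hi⟩ := exists_pos_coord hp0 (ND.ray_ne_zero_of_isSmoothCone hσ hp)
    intro h0
    have h1 : y i = 0 := by rw [h0]; rfl
    have h2 : 0 < xPt m m' p q i := by
      simp only [xPt, Pi.add_apply, Pi.smul_apply, smul_eq_mul]; nlinarith [hq0 i]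
    simp only [hy, Pi.add_apply, Pi.smul_apply, smul_eq_mul] at h1
    nlinarith [hxrq i]
  -- the node direction of `y` is a ray `ρ''` of the position; FAN EXCLUSION puts it in `σ`
  obtain ⟨w, hw, a', b', ha', hb', hyw⟩ := exists_nodeDir hnode hy0 hyne
  obtain ⟨σ'', hσ'', ρ'', hρ'', a'', b'', ha'', hb'', hwρ⟩ := hN w hw
  have hcomb : (b' * b'') • ρ'' = (a'' * a') • y := by
    calc (b' * b'') • ρ'' = b' • (b'' • ρ'') := mul_smul _ _ _
      _ = b' • (a'' • w) := by rw [hwρ]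
      _ = a'' • (b' • w) := smul_comm _ _ _
      _ = a'' • (a' • y) := by rw [hyw]
      _ = (a'' * a') • y := (mul_smul _ _ _).symm
  have hyexp : y = (B * (-lin (zOf m m') q)) • p + (B * lin (zOf m m') p + A * lin (zOf m m') r) • q + (A * (-lin (zOf m m') q)) • r := by
    simp only [hy, xPt]; ext i; simp only [Pi.add_apply, Pi.smul_apply, smul_eq_mul]; ring
  have hρ''σ : ρ'' ∈ σ := by
    refine mem_of_smul_eq_three hSep hσF hσ'' hρ'' (mul_pos hb' hb'') hp hq hr
      (cp := (a'' * a') * (B * (-lin (zOf m m') q))) (cq := (a'' * a') * (B * lin (zOf m m') p + A * lin (zOf m m') r))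
      (cr := (a'' * a') * (A * (-lin (zOf m m') q))) ?_ ?_ ?_ ?_
    · exact mul_nonneg (by positivity) (mul_nonneg hB.le (by linarith))
    · exact mul_nonneg (by positivity) (add_nonneg (mul_nonneg hB.le hlp.le) (mul_nonneg hA hlr.le))
    · exact mul_nonneg (by positivity) (mul_nonneg hA (by linarith))
    · rw [hcomb, hyexp, smul_add, smul_add, smul_smul, smul_smul, smul_smul]
  -- but `ℓ ρ'' = 0`, while `ℓ` does not vanish on the (at most three) rays `p, q, r` of `σ`
  have hlρ : lin (zOf m m') ρ'' = 0 := by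
    have := congr_arg (lin (zOf m m')) hcomb
    rw [lin_smul, lin_smul, hly, mul_zero] at this
    rcases mul_eq_zero.1 this with h | h
    · exact absurd h (mul_pos hb' hb'').ne'
    · exact h
  have hpq : p ≠ q := by rintro rfl; linarith
  have hqr : q ≠ r := by rintro rfl; linarith
  rcases mem_three_of_card_le hcard hp hq hr hpq hqr hrp hρ''σ with rfl | rfl | rfl
  · linarith
  · linarith
  · linarith

/-- **THE EXTREME PROPERTY (negative side)**, by the swap symmetry. [OURS · L1 W4.5b · brick 2c] -/
theorem wcross_of_wcross_of_neg {V : Finset (Fin 3 → ℕ)} {F : Finset (Finset (Ray 3))} (hSep : Separated F) (hN : NodesResolved V F)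
    {σ : Finset (Ray 3)} (hσF : σ ∈ F) (hσ : ND.IsSmoothCone σ) (hcard : σ.card ≤ 3) {m m' : Fin 3 → ℕ} (hm : m ∈ V) (hm' : m' ∈ V)
    (hmm' : m ≠ m') {p q r : Ray 3} (hp : p ∈ σ) (hq : q ∈ σ) (hr : r ∈ σ) (hrq : r ≠ q)
    (hW : WCross V m m' p q) (hlr : lin (zOf m m') r < 0) : WCross V m m' p r := by
  have h1 : WCross V m' m q p := wcross_swap hW
  have hlr' : 0 < lin (zOf m' m) r := by
    have : lin (zOf m' m) r = -lin (zOf m m') r := by rw [lin_zOf, lin_zOf]; ring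
    rw [this]; linarith
  exact wcross_swap (wcross_of_wcross_of_pos hSep hN hσF hσ hcard hm' hm (Ne.symm hmm') hq hp hr hrq h1 hlr')

/-- `NoWCross V m m' F`: no cone of `F` contains a W-crossing pair for `(m, m')`. [OURS · bookkeeping] -/
def NoWCross (V : Finset (Fin 3 → ℕ)) (m m' : Fin 3 → ℕ) (F : Finset (Finset (Ray 3))) : Prop :=
  ∀ σ ∈ F, ∀ u ∈ σ, ∀ v ∈ σ, ¬ WCross V m m' u v

/-- **PHASE 2 for one ordered pair `(m, m')`** (inner loop on the one-wall measure of brick 1a): from a position reachable from the orthant in which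
every node direction is a ray, some E1-legal continuation — stars at W-crossing pairs maximising `ℓ p − ℓ q` — reaches a position with no W-crossing
pair for `(m, m')`, node directions still rays. [OURS · L1 W4.5b · brick 2c] -/
theorem phase2_pair (V : Finset (Fin 3 → ℕ)) {m m' : Fin 3 → ℕ} (hm : m ∈ V) (hm' : m' ∈ V) (hmm' : m ≠ m') :
    ∀ (M : ℕ) (F : Finset (Finset (Ray 3))), Reach V (orthantFan 3) F → NodesResolved V F → measure (zOf m m') F ≤ M →
      ∃ F', Reach V F F' ∧ NodesResolved V F' ∧ NoWCross V m m' F' := by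
  classical
  intro M
  induction M with
  | zero =>
    intro F hR hN hM
    refine ⟨F, Reach.refl F, hN, fun σ hσ u hu v hv hW => ?_⟩
    have hC : Crossing (zOf m m') σ := ⟨⟨u, hu, hW.1⟩, ⟨v, hv, hW.2.1⟩⟩
    have h1 : weight (zOf m m') σ ≤ measure (zOf m m') F :=
      Finset.single_le_sum (f := weight (zOf m m')) (fun _ _ => Nat.zero_le _) hσ
    have h2 : weight (zOf m m') σ = 3 ^ (posSum (zOf m m') σ * negSum (zOf m m') σ) := if_pos hC
    have h3 : 0 < 3 ^ (posSum (zOf m m') σ * negSum (zOf m m') σ) := pow_pos (by norm_num) _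
    omega
  | succ M ih =>
    intro F hR hN hM
    by_cases hex : ∃ σ ∈ F, ∃ u ∈ σ, ∃ v ∈ σ, WCross V m m' u v
    · -- invariants of the position
      have hS : ∀ σ ∈ F, ND.IsSmoothCone σ := fun σ hσ => ND.isSmoothCone_of_reach_orthant V hR hσ
      have hcard : ∀ σ ∈ F, σ.card ≤ 3 := card_le_three_of_reach_orthant le_rfl V hR
      have hSep : Separated F := separated_of_reach_orthant V hR
      -- the W-crossing pair maximising `ℓ p − ℓ q`
      let S : Finset (Ray 3 × Ray 3) := F.biUnion (fun σ => (σ ×ˢ σ).filter (fun uv => WCross V m m' uv.1 uv.2))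
      have hSmem : ∀ uv : Ray 3 × Ray 3, uv ∈ S ↔ ∃ σ ∈ F, uv.1 ∈ σ ∧ uv.2 ∈ σ ∧ WCross V m m' uv.1 uv.2 := by
        intro uv
        simp only [S, Finset.mem_biUnion, Finset.mem_filter, Finset.mem_product]
        constructor
        · rintro ⟨σ, hσ, ⟨h1, h2⟩, h3⟩; exact ⟨σ, hσ, h1, h2, h3⟩
        · rintro ⟨σ, hσ, h1, h2, h3⟩; exact ⟨σ, hσ, ⟨h1, h2⟩, h3⟩
      have hSne : S.Nonempty := by
        obtain ⟨σ, hσ, u, hu, v, hv, hW⟩ := hex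
        exact ⟨(u, v), (hSmem (u, v)).2 ⟨σ, hσ, hu, hv, hW⟩⟩
      obtain ⟨⟨p, q⟩, hpqS, hmaxS⟩ := S.exists_max_image (fun uv => lin (zOf m m') uv.1 - lin (zOf m m') uv.2) hSne
      obtain ⟨σ₀, hσ₀, hp, hq, hW⟩ := (hSmem (p, q)).1 hpqS
      have hp0 : 0 < lin (zOf m m') p := hW.1
      have hq0 : lin (zOf m m') q < 0 := hW.2.1
      have hext : ∀ σ ∈ F, p ∈ σ → q ∈ σ →
          (∀ ρ ∈ σ, lin (zOf m m') ρ ≤ lin (zOf m m') p) ∧ (∀ ρ ∈ σ, lin (zOf m m') q ≤ lin (zOf m m') ρ) := by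
        intro σ hσ hpσ hqσ
        refine ⟨fun ρ hρ => ?_, fun ρ hρ => ?_⟩
        · by_cases h : 0 < lin (zOf m m') ρ
          · by_cases hρp : ρ = p
            · rw [hρp]
            · have hWρ : WCross V m m' ρ q :=
                wcross_of_wcross_of_pos hSep hN hσ (hS σ hσ) (hcard σ hσ) hm hm' hmm' hpσ hqσ hρ hρp hW h
              have := hmaxS (ρ, q) ((hSmem (ρ, q)).2 ⟨σ, hσ, hρ, hqσ, hWρ⟩)
              dsimp only at this; linarith
          · linarith
        · by_cases h : lin (zOf m m') ρ < 0
          · by_cases hρq : ρ = q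
            · rw [hρq]
            · have hWρ : WCross V m m' p ρ :=
                wcross_of_wcross_of_neg hSep hN hσ (hS σ hσ) (hcard σ hσ) hm hm' hmm' hpσ hqσ hρ hρq hW h
              have := hmaxS (p, ρ) ((hSmem (p, ρ)).2 ⟨σ, hσ, hpσ, hρ, hWρ⟩)
              dsimp only at this; linarith
          · linarith
      -- the star
      have hpq : p ≠ q := by rintro rfl; exact lt_irrefl _ (hq0.trans hp0)
      have hτσ₀ : ({p, q} : Finset (Ray 3)) ⊆ σ₀ := by
        rw [Finset.insert_subset_iff, Finset.singleton_subset_iff]; exact ⟨hp, hq⟩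
      have hτne : ({p, q} : Finset (Ray 3)).Nonempty := ⟨p, Finset.mem_insert_self _ _⟩
      have hR₁ : Reach V F (star F {p, q}) := Reach.step F F {p, q} σ₀ (Reach.refl F) hσ₀ hτσ₀ hτne (bad_of_wcross hm hm' hW)
      have hR₁' : Reach V (orthantFan 3) (star F {p, q}) := reach_trans V hR₁ hR
      have hN₁ : NodesResolved V (star F ({p, q} : Finset (Ray 3))) :=
        nodesResolved_star hN ⟨p, Finset.mem_insert_self _ _, q, Finset.mem_insert_of_mem (Finset.mem_singleton_self _), hpq⟩
      have hlt : measure (zOf m m') (star F ({p, q} : Finset (Ray 3))) < measure (zOf m m') F :=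
        measure_star_lt (zOf m m') hcard hp0 hq0 hext hσ₀ hp hq
      obtain ⟨F', hR', hN', hno⟩ := ih (star F {p, q}) hR₁' hN₁ (by omega)
      exact ⟨F', reach_trans V hR' hR₁, hN', hno⟩
    · refine ⟨F, Reach.refl F, hN, fun σ hσ u hu v hv hW => hex ⟨σ, hσ, u, hu, v, hv, hW⟩⟩


end FanGame

end Summit.ResolutionOfSingularities.ResolutionOfSingularities.Cruxes.EquisingularLiftNat.Sections
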